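import Summits.QuantumFields.BalabanUV.T4Continuum.Support.NE7FlatSliceChain
import Summits.QuantumFields.BalabanUV.T4Continuum.Support.NE7StraightSliceB5Letter
import HarnessLib

/-!
# NE7FlatSliceEnd — row NE7 (node U5): F54 v3's SLICE-SOLVER LETTER `hG` — the (A)-bill's XL(c) DRIVER — **PROVED** on every cubic torus `N ≥ 1`, `L ≥ 2`, every `k`,
# with `K_G = (1 + 2(d+1)·C_fr(d+1,L))·(2n³·(L^(k+1)·K(d)))`, by (142) `sliceSolver_end_of_rankOneSourceSolver` ∘ (151) `rankOneSourceSolver_holds`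

Lineage `b2b-balaban-t4-ne7-p2` (CRUX PROVER NE7 #2, co-owner of row NE7), generation 84 (staged behind (142) p381062 and (151)).  The chain (137)→(152) of this generation:
duality socket (137), normal form (138), straight reduction (139), rank one (141), chain (142) ‖ chart (143), curl∕inverse chart (144), forms (145), Bałaban's gauge λ₀ (146),
transfer (147), constrained Green operator (148), split (149), adjoint sup (150), letter (151, fed by lit-balaban's `B5G115SupBound` and the G-an2-4 team's
`GAN24.Entry115SupCubic` ∕ `GAN24.AveragedPropagatorInverseUniform`) ‖ this END.
WHAT.  **`sliceSolver_end_holds`**: for every `d ≥ 1`, `L ≥ 2` there is `K ≥ 0` (free of `k`, `N`) such that for every `N ≥ 1`, `k`, every skew `L^(k+1)·N`-periodic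
`X : Site (d+1) → Fin (d+1) → Matrix n n ℂ` with `dirIter L (k+1) 1 X = 0` whose flat Hessian functional is `g·ℓ¹`-bounded on that slice has `‖curlAt 1 X z μ ν‖ ≤ K·L^(k+1)·g` —
F54 v3's hypothesis `hG` VERBATIM IN ITS OWN CURRENCY (`smallField_of_trivialLetters_currency` takes `{K} (hK : 0 ≤ K)` and `hG` with `K * (L : ℝ) ^ (k + 1) * g`; its docstring:
«with the solver constant K_G = K·M», `M = L^{k+1}`), now a theorem: `obtain ⟨K, hK, hG⟩ := sliceSolver_end_holds d hd hL` discharges that pair of hypotheses.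
HONEST FRAMING (page 1): composition BY NAME; the analysis behind `K(d)` is lit-balaban's pv15 (`B5G115SupBound`, (1.83)∕(1.89) kernels), the G-an2-4 swarm's ((1.110) per-block
bounds, (1.66) strip analyticity) and the β sub-cell's (`Beta.FluctuationProjection`); `a = 1`, `U = 1` (FLAT background — this is the letter AT THE TRIVIAL CONFIGURATION, as F54 v3
asks); NOT (APE) itself, NOT ONE-STEP, NOT NE7; spine 0∕9; finite T⁴ rung (B)+1 — NOT infinite volume, NOT mass gap, NOT Clay.  Continuum YM on T⁴ ⇐ BetaPertH ∧ nine spine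
estimates (0/9 proved); BetaPertH ⇐ (D1) ∧ (D4) ∧ CAP+tail; G-an2-4 gates asym, D1 and NE2/3/4.
-/

set_option autoImplicit false

open scoped BigOperators Matrix Matrix.Norms.L2Operator
open Finset

namespace Summit.QuantumFields.BalabanUV.T4Continuum.NE7FlatSliceEnd

open Literature.MathematicalPhysics.QuantumFieldTheory.Balaban1983to89
open B7Prop1Explicit
open T4AveragingDeficitWall (curlAt dirL1 IsSkewDir)
open T4AveragingDeficitWallBoundary (periodBox)
open AveragingDeficitPeriodicCounting (IsPeriodicDir)
open MinimalActionLevels (perWin)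
open BlockAveragePushDirSplit (flat)
open NE3HessForm (hess)
open NE3TangentCovariantTower (dirIter)
open NE7FlatSliceStraightReduction (Cfr)
open NE7FlatSliceChain (sliceSolver_end_of_rankOneSourceSolver)
open NE7StraightSliceB5Letter (rankOneSourceSolver_holds)

noncomputable section

variable {n : Type} [Fintype n] [DecidableEq n]

/-- **F54 v3's SLICE-SOLVER LETTER `hG` HOLDS** on every cubic torus, IN THE END's CURRENCY `K_G = K·L^(k+1)` (`smallField_of_trivialLetters_currency`'s `{K} (hK : 0 ≤ K) (hG : … ≤
K * L^(k+1) * g)`): for every `d ≥ 1`, `L ≥ 2` there is `K ≥ 0` (`= (1 + 2(d+1)·C_fr(d+1,L))·(2·(card n)³·K(d))`, free of `k` and `N`) such that for all `N ≥ 1`, `k` the END-shaped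
letter holds with constant `K·L^(k+1)`. [cite: Balaban1984PropagatorsI, (1.103) p.34, (1.115) p.36] -/
theorem sliceSolver_end_holds [Nonempty n] (d : ℕ) (hd : 1 ≤ d) {L : ℕ} (hL : 2 ≤ L) :
    ∃ K : ℝ, 0 ≤ K ∧ ∀ (N : ℕ) [NeZero N] (k : ℕ),
      ∀ X : Site (d + 1) → Fin (d + 1) → Matrix n n ℂ, IsSkewDir X → IsPeriodicDir X ((L ^ (k + 1) * N : ℕ) : ℤ) →
        dirIter L (k + 1) (flat (d := d + 1) (n := n)) X = 0 → ∀ g : ℝ, 0 ≤ g →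
        (∀ Y : Site (d + 1) → Fin (d + 1) → Matrix n n ℂ, IsSkewDir Y → IsPeriodicDir Y ((L ^ (k + 1) * N : ℕ) : ℤ) →
          dirIter L (k + 1) (flat (d := d + 1) (n := n)) Y = 0 →
          |hess (flat (d := d + 1) (n := n)) X Y (perWin (d + 1) (L ^ (k + 1) * N))| ≤ g * dirL1 Y (periodBox (d := d + 1) (L ^ (k + 1) * N))) →
        ∀ (z : Site (d + 1)) (μ ν : Fin (d + 1)), μ ≠ ν →
          ‖curlAt (flat (d := d + 1) (n := n)) X z μ ν‖ ≤ K * (L : ℝ) ^ (k + 1) * g := by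
  obtain ⟨K₀, hK₀, hK⟩ := rankOneSourceSolver_holds d
  haveI : NeZero L := ⟨by omega⟩
  have hCfr : 0 ≤ Cfr (d + 1) L := by unfold NE7FlatSliceStraightReduction.Cfr; positivity
  refine ⟨(1 + 2 * ((d + 1 : ℕ) : ℝ) * Cfr (d + 1) L) * (2 * (Fintype.card n : ℝ) ^ 3 * K₀), by positivity, fun N _ k => ?_⟩
  intro X hXs hXP hX0 g hg hXg z μ ν hμν
  have hP : 2 ≤ L ^ (k + 1) * N :=
    calc 2 ≤ L := hL
      _ ≤ L ^ (k + 1) := Nat.le_self_pow (Nat.succ_ne_zero k) L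
      _ ≤ L ^ (k + 1) * N := Nat.le_mul_of_pos_right _ (Nat.pos_of_ne_zero (NeZero.ne N))
  have h := sliceSolver_end_of_rankOneSourceSolver hd hL k (hK L (by omega) (k + 1) N hP) X hXs hXP hX0 g hg hXg z μ ν hμν
  calc _ ≤ _ := h
    _ = (1 + 2 * ((d + 1 : ℕ) : ℝ) * Cfr (d + 1) L) * (2 * (Fintype.card n : ℝ) ^ 3 * K₀) * (L : ℝ) ^ (k + 1) * g := by push_cast; ring

end

end Summit.QuantumFields.BalabanUV.T4Continuum.NE7FlatSliceEnd
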